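import Literature.MathematicalPhysics.QuantumChemistry.T2Condition
import Literature.MathematicalPhysics.QuantumChemistry.PositivityBlockTraces
import HarnessLib

/-!
# The `T2` / `T2′` trace data, II: linear-functional form, compressed-block bookkeeping, Loewner form,
# state form — and an audit of the printed value

Topic `Literature/MathematicalPhysics/QuantumChemistry`; SIBLING of `PositivityBlockTraces.lean` (chem-type-08:
the a-priori trace CONSTANTS of the three-index blocks on the `N`-electron DQG-feasible set,
`IsDQGFeasible.trace_t2Map` **`tr T2 = N(r(r−1) − (r−2)(N−1))`** `(= rN(r−N) + 2N(N−1))`,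
`IsDQGFeasible.trace_t2PrimeMap` **`tr T2′ = tr T2 + N`**, `IsDQGFeasible.trace_t1Map`, and the sub-block
rule `re_sum_diag_submatrix_le_of_posSemidef` — all IMPORTED and used here, none restated), of
`T2Condition.lean` (the `T2` / `T2′` conditions as named predicates, the `PQGT1T2` rung
`IsDQGT1T2Feasible`) and of `T2ConditionTraceSector.lean` (the exact `S_z`-block constants on
`IsDQGFeasibleSector`). HONEST FRAMING (cell chem-oracle, LADDER-CHEM I-TYPE slot 05): statements about a
finite model Hamiltonian's reduced density matrices and their semidefinite relaxations; this file certifies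
no number.

THE PRINTED SOURCE. Chaykin, Jansson, Keil, Lange, Ohlhus and Rump (2016) §4.1 obtain the a-priori primal
data of the rigorous (a-posteriori) SDP error bound for the electronic-structure programme from traces:
"For computing rigorous error bounds for the electronic structure problem, eigenvalue bounds of the matrix
variables are important and can reduce the computing time drastically. In this section we derive eigenvalue
bounds for … each block of the matrix variable `X = diag(γ, I−γ, Γ, Q, G, T1, T2)`" [p. 14]; "an immediate
upper bound of its eigenvalues can be obtained from its trace condition (3.32), namely `λmax(Γ) ≤ tr(Γ)`
… From the N-representability equations … we calculate the traces of the matrices `G, Q, T1`, and `T2`.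
… `tr(T2) = −rN(N−1) + r²N − rN = rN(r−N)`, `tr(T2′) = tr(T2) + tr(γ)` (4.5). Hence the upper
eigenvalue bounds … `λmax(T2) ≤ Nr(r−N)`, `λmax(T2′) ≤ N(r(r−N)+1)` (4.6)" [p. 15].
[cite: ChaykinEtAl2016RigorousESC, §4.1 eqs. (4.4)-(4.6), pp. 14-15]

WHAT IS PROVED HERE (0 sorry, no definition, no named fact), for the tree's `T2` functional `t2Map γ Γ`
(Nakata et al. 2008 §II.A; on a state `= ⟨ψ| C_I C_J† + C_J† C_I |ψ⟩`, `C_{(ijk)} = a†_i a†_j a_k`,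
`t2Map_rdm`) and its bordered form `t2PrimeMap γ Γ = ( T2 X ; X† γ )` (§II.B), `r = |ι|` spin orbitals:
* `t2Map_apply_diag'` — the diagonal entry for ALL index patterns (the companion lemma
  `t2Map_apply_diag` of `WeinholdWilsonInequalities.lean` has `i ≠ j`; `sum_t2Map_diag` of the sibling is
  its `k`-sum); `trace_t2Map`, `trace_t2PrimeMap` — the trace as a LINEAR FUNCTIONAL of an ARBITRARY pair
  (no feasibility): `tr T2(γ, Γ) = (2 − r)·tr Γ + r(r−1)·tr γ`, `tr T2′ = tr T2 + tr γ` (the printed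
  `tr(T2′) = tr(T2) + tr(γ)`); on the feasible set (`tr γ = N`, `tr Γ = N(N−1)`) this is the sibling's
  constant;
* `IsDQGFeasible.t2Map_diag_swap`, `IsDQGFeasible.t2Map_diag_eq_zero` — THE COMPRESSED-BLOCK
  BOOKKEEPING as kernel facts: on the feasible set the diagonal entry is symmetric under
  `(i, j, k) ↦ (j, i, k)` and the rows `a†_i a†_i a_k` carry none of the trace, so a programme that keeps
  ONE member of each antisymmetric pair of rows (the `r²(r−1)/2`-dimensional `T2` block of the SDP codes,
  Chaykin et al. §3.3 `svec`) carries exactly HALF of the sibling's constant: `½ rN(r−N) + N(N−1)`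
  (`+ N` for `T2′`, whose border rows are unpaired) — the sibling leaves "that bookkeeping [to] the reader";
* `posSemidef_trace_smul_one_sub_of_posSemidef` — `A ⪰ 0 ⇒ (tr A)·1 − A ⪰ 0`, the printed step
  "`λmax ≤ tr`" as a matrix inequality; hence `IsDQGT1T2Feasible.trace_smul_one_sub_t2Map_posSemidef` and
  `IsDQGT1T2PrimeFeasible.trace_smul_one_sub_t2PrimeMap_posSemidef` — the EIGENVALUE FORM (4.6),
  `τ·1 − T2 ⪰ 0` on the `PQGT1T2` rung and `τ′·1 − T2′ ⪰ 0` on the `PQGT1T2′` rung with the sibling's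
  `τ = N(r(r−1) − (r−2)(N−1))`, `τ′ = τ + N` — the hypothesis shape `x̄·1 − X ⪰ 0` of
  `Literature.Computation.Certificates.JanssonChaykinKeil.theorem_3_2` (the sibling serves the trace form
  `….theorem_3_2_traceBound` / `APosteriori.IsEncodingOf`);
* `trace_t2Anticomm_of_isNParticle`, `trace_t2Prime_of_isNParticle` — the STATE forms: the traces of the
  `T2` matrix of `ThreeIndexConditionsTwoRDM.lean` and of the `T2′` matrix of
  `ThreeIndexConditionsT2Prime.lean` of a unit `N`-particle vector (the shape used by the LMI/moment
  encodings `APosteriori.IsSectorRelaxationLMI`, whose `τ_q` bound traces of blocks evaluated at the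
  moments of a state).

AUDIT NOTE ON THE PRINTED VALUE (REFEREE R4: a number the kernel contradicts in print is reported as a fact
about the print). Chaykin et al. define `T2` by the SAME operator expectation as the tree,
"`T2(i,j,k;i′,j′,k′) = ⟨Ψ| a⁺_k a⁺_j a_i a⁺_{i′} a_{j′} a_{k′} + a⁺_{i′} a_{j′} a_{k′} a⁺_k a⁺_j a_i |Ψ⟩`"
(their eq. (3.40), p. 11; = Verstichel 2012 §2.2.2 `(T₂)`, = the tree's `t2_anticomm_form_apply` with the
triples reversed, `(i,j,k)_tree = (k,j,i)_CJKLOR`), with `Γ(i,j;i′,j′) = ⟨a⁺_{i′}a⁺_{j′}a_j a_i⟩` of trace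
`N(N−1)` (their (3.29), (3.32)) — the tree's normalisation. For that matrix the kernel-checked trace over
all `(i,j,k) ∈ [r]³` is `rN(r−N) + 2N(N−1)` (the sibling's `IsDQGFeasible.trace_t2Map`; here `trace_t2Map`
with `tr γ = N`, `tr Γ = N(N−1)`; independently `Σ_I ‖C_I ψ‖² + ‖C_I† ψ‖² = N(r−N+1)(r−N) + (r−N+2)N(N−1)`
by normal ordering); the printed `tr(T2) = rN(r−N)` of (4.5) is smaller by `2N(N−1)`. Hand witness:
`r = 2`, `N = 2`, `ψ = a†_1 a†_2 |0⟩`: `Σ_{ijk} ‖a†_k a_j a_i ψ‖² = 4` (`(i,j) ∈ {(1,2),(2,1)}`,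
`k ∈ {1,2}`), all `a†a†a ψ = 0`, so `tr T2 = 4`, whereas `rN(r−N) = 0`. The source of the discrepancy is
the entry formula printed under (3.40): its fourth term `−δ(j,k′)Γ(j′,i;k,i′)` carries the opposite sign to
the normal-ordered expansion of the operator line (which gives `+δ(j,k′)Γ(j′,i;k,i′)`, the
`(j↔k)`-antisymmetric partner of `+δ(k,j′)Γ(k′,i;j,i′)` — with the printed sign the displayed matrix is
not antisymmetric in `(j,k)`, contradicting the sentence after (3.40)); the printed trace
`−rN(N−1) + r²N − rN` is exactly the trace of the displayed formula, in which the two `j = k`-diagonal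
contributions `∓N(N−1)` cancel instead of adding. CONSEQUENCES: (i) read literally for the full-cube
operator matrix the printed bounds (4.6) can fail: for `r = N = 2` (`ψ = a†_1 a†_2 |0⟩`) `T2` has the
eigenvalue `2` (on `e_{(1,2,k)} − e_{(2,1,k)}`) while the printed `λmax(T2) ≤ Nr(r−N) = 0`, and for
`r = N = 3` (`ψ = a†_1 a†_2 a†_3 |0⟩`) `T2`, hence `T2′`, has the eigenvalue `4` while the printed
`λmax(T2′) ≤ N(r(r−N)+1) = 3`; (ii) for the COMPRESSED blocks of the deposited SDPA instances (one member
per antisymmetric pair, trace `½ rN(r−N) + N(N−1)` resp. `+ N` for `T2′`, by the bookkeeping lemmas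
below) the printed bounds still dominate the trace whenever `r(r−N) ≥ 2(N−1)`, in particular for every
instance with `r ≥ N + 2`, so no certified number of that paper is affected — only the identity as
printed; (iii) generators of this cell take `τ_T2`, `τ_T2′` from the sibling's theorems (or from their own
exact diagonal sums), not from (4.5)–(4.6). The journal version (J. Chem. Theory Comput. 16 (2020) 7342,
not held: acq-09291) may have corrected the sign; this note is about the 2016 preprint as held
[paper:url-8a9601dd32ed, pp. 11, 15].

References: D. Chaykin, C. Jansson, F. Keil, M. Lange, K. T. Ohlhus, S. M. Rump, *Rigorous results in
electronic structure calculations*, Optimization Online 2016/11/5730, §3.1 eqs. (3.29), (3.32), (3.40),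
§3.3, §4.1 eqs. (4.4)–(4.6) [ChaykinEtAl2016RigorousESC]; M. Nakata, B. J. Braams, K. Fujisawa, M. Fukuda,
J. K. Percus, M. Yamashita, Z. Zhao, J. Chem. Phys. 128 (2008) 164113, §II.A–B [NakataEtAl2008].
Tree (REUSED, cited by name): `t2Map`, `t2Map_apply`, `t2PrimeMap`, `t2Map_rdm`, `t2PrimeMap_rdm`,
`IsDQGT1T2PrimeFeasible` (`ThreeIndexRelaxationBound`); `IsDQGT1T2Feasible` (`T2Condition`); `IsDQGFeasible`
(`VariationalRDMRelaxation`); `IsDQGFeasible.trace_t2Map / trace_t2PrimeMap` (`PositivityBlockTraces`);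
Mathlib's `Matrix.IsHermitian.spectral_theorem`. NOT here: the `T1` block (slot 04 / the sibling), the
sector (`S_z`-block) constants (`T2ConditionTraceSector.lean`), point-group blocks.
-/

noncomputable section

namespace Literature.MathematicalPhysics.QuantumChemistry

open Matrix Finset Literature.MathematicalPhysics.QuantumLattice
open scoped ComplexOrder

/-! ### §0 Plumbing: `A ⪰ 0 ⇒ (tr A)·1 − A ⪰ 0` (every eigenvalue of a PSD matrix is at most its trace) -/

section Loewner

variable {n : Type*} [Fintype n] [DecidableEq n]

/-- **`λ_max(X) ≤ tr X` for `X ⪰ 0`, in Loewner form**: for a positive semidefinite complex matrix `A`,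
`(tr A)·1 − A ⪰ 0`. Proof: `A = U diag(λ) U*` with `λ_i ≥ 0`, so `(tr A)·1 − A = U diag(Σ_j λ_j − λ_i) U*`
with a nonnegative diagonal. This is the step "an immediate upper bound of its eigenvalues can be obtained
from its trace condition, `λmax(Γ) ≤ tr(Γ)`" of Chaykin et al. (2016) §4.1, recorded as a matrix inequality
so that it feeds `JanssonChaykinKeil.theorem_3_2` (`x̄·1 − X ⪰ 0`).
[cite: ChaykinEtAl2016RigorousESC, §4.1, sentence before eq. (4.3), p. 15] -/
theorem posSemidef_trace_smul_one_sub_of_posSemidef {A : Matrix n n ℂ} (hA : A.PosSemidef) :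
    (A.trace • (1 : Matrix n n ℂ) - A).PosSemidef := by
  obtain ⟨t, ht⟩ : ∃ t : ℂ, A.trace = t := ⟨_, rfl⟩
  rw [ht]
  have hH : A.IsHermitian := hA.1
  set U : Matrix n n ℂ := (hH.eigenvectorUnitary : Matrix n n ℂ) with hU
  have h1 : U * star U = 1 := Matrix.mem_unitaryGroup_iff.1 hH.eigenvectorUnitary.2
  have hspec : A = U * diagonal (RCLike.ofReal ∘ hH.eigenvalues) * star U := by
    have hs := hH.spectral_theorem
    rw [Unitary.conjStarAlgAut_apply] at hs
    simpa [hU] using hs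
  have hsum : t = ∑ i, (RCLike.ofReal (hH.eigenvalues i) : ℂ) := by
    rw [← ht]; exact hH.trace_eq_sum_eigenvalues
  -- the diagonal matrix of `t − λ_i` is positive semidefinite
  have hD : (diagonal fun i => t - (RCLike.ofReal (hH.eigenvalues i) : ℂ)).PosSemidef := by
    rw [posSemidef_diagonal_iff]
    intro i
    rw [hsum, ← map_sum (algebraMap ℝ ℂ), RCLike.algebraMap_eq_ofReal, ← RCLike.ofReal_sub]
    exact RCLike.ofReal_nonneg.2
      (sub_nonneg.2 (Finset.single_le_sum (fun j _ => hA.eigenvalues_nonneg j) (Finset.mem_univ i)))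
  -- and conjugating it by `U` gives `t·1 − A`
  have hdiag : (diagonal fun i => t - (RCLike.ofReal (hH.eigenvalues i) : ℂ)) =
      t • (1 : Matrix n n ℂ) - diagonal (RCLike.ofReal ∘ hH.eigenvalues) := by
    ext i j
    by_cases hij : i = j
    · subst hij; simp
    · simp [hij]
  have key : t • (1 : Matrix n n ℂ) - A =
      U * (diagonal fun i => t - (RCLike.ofReal (hH.eigenvalues i) : ℂ)) * Uᴴ := by
    rw [hdiag, Matrix.mul_sub, Matrix.sub_mul, Matrix.mul_smul, Matrix.mul_one, Matrix.smul_mul,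
      ← star_eq_conjTranspose, h1, ← hspec]
  rw [key]
  exact hD.mul_mul_conjTranspose_same U

end Loewner

/-! ### §1 The trace of `T2` and `T2′` as linear functionals of an arbitrary pair -/

section Abstract

variable {ι : Type*} [LinearOrder ι] [Fintype ι]

omit [Fintype ι] in
/-- **Diagonal entry of the `T2` functional** (all index patterns): for the row `C_{(ijk)} = a†_i a†_j a_k`,
`T2^{ijk}_{ijk} = Γ^{ij}_{ij} − Γ^{kj}_{kj} − Γ^{ki}_{ki} + γ^k_k + [i = j](Γ^{ki}_{kj} + Γ^{kj}_{ki} − γ^k_k)`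
— Nakata et al. (2008) §II.A, the seven printed monomials of `t2Map_apply` on the diagonal (the companion
file `WeinholdWilsonInequalities.lean` has the case `i ≠ j` as `t2Map_apply_diag`).
[cite: NakataEtAl2008, §II.A] -/
theorem t2Map_apply_diag' (γ : Matrix ι ι ℂ) (Γ : Matrix (ι × ι) (ι × ι) ℂ) (i j k : ι) :
    t2Map γ Γ (i, j, k) (i, j, k) =
      Γ (i, j) (i, j) - Γ (k, j) (k, j) - Γ (k, i) (k, i) + γ k k +
        (if i = j then Γ (k, i) (k, j) + Γ (k, j) (k, i) - γ k k else 0) := by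
  rw [t2Map_apply]
  by_cases hij : i = j
  · subst hij
    simp only [reduceIte]
    ring
  · simp only [reduceIte, if_neg hij, if_neg (Ne.symm hij)]
    ring

/-- **The trace of `T2` is a linear functional of the pair** (sum form): summing the diagonal over all
`(i, j, k) ∈ ι³` (`r = |ι|` spin orbitals),
`Σ_{ijk} T2^{ijk}_{ijk} = (2 − r)·Σ_p Γ^p_p + r(r−1)·Σ_i γ^i_i` — the computation "we calculate the traces
of the matrices … `T2`" of Chaykin et al. (2016) §4.1 eq. (4.5), carried out for the operator-defined
matrix of their eq. (3.40) (= the tree's `t2Map`) on an ARBITRARY pair (see the module docstring for the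
`2N(N−1)` discrepancy with the printed value on the feasible set).
[cite: ChaykinEtAl2016RigorousESC, §4.1 eq. (4.5)] -/
theorem sum_diag_t2Map_eq_linear (γ : Matrix ι ι ℂ) (Γ : Matrix (ι × ι) (ι × ι) ℂ) :
    ∑ I : ι × ι × ι, t2Map γ Γ I I =
      (2 - (Fintype.card ι : ℂ)) * ∑ p : ι × ι, Γ p p +
        (Fintype.card ι : ℂ) * ((Fintype.card ι : ℂ) - 1) * ∑ i, γ i i := by
  have hΓ : ∑ p : ι × ι, Γ p p = ∑ i, ∑ j, Γ (i, j) (i, j) := Fintype.sum_prod_type _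
  -- expand the diagonal
  have h0 : ∑ I : ι × ι × ι, t2Map γ Γ I I =
      ∑ i, ∑ j, ∑ k, (Γ (i, j) (i, j) - Γ (k, j) (k, j) - Γ (k, i) (k, i) + γ k k +
        (if i = j then Γ (k, i) (k, j) + Γ (k, j) (k, i) - γ k k else 0)) := by
    rw [Fintype.sum_prod_type]
    refine Finset.sum_congr rfl fun i _ => ?_
    rw [Fintype.sum_prod_type]
    refine Finset.sum_congr rfl fun j _ => Finset.sum_congr rfl fun k _ => ?_
    exact t2Map_apply_diag' γ Γ i j k
  -- the five pieces
  have h1 : ∑ i : ι, ∑ j : ι, ∑ _k : ι, Γ (i, j) (i, j) = (Fintype.card ι : ℂ) * ∑ p : ι × ι, Γ p p := by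
    rw [hΓ, Finset.mul_sum]
    refine Finset.sum_congr rfl fun i _ => ?_
    rw [Finset.mul_sum]
    refine Finset.sum_congr rfl fun j _ => ?_
    rw [Finset.sum_const, Finset.card_univ, nsmul_eq_mul]
  have h2 : ∑ _i : ι, ∑ j : ι, ∑ k : ι, Γ (k, j) (k, j) = (Fintype.card ι : ℂ) * ∑ p : ι × ι, Γ p p := by
    rw [Finset.sum_const, Finset.card_univ, nsmul_eq_mul, hΓ, Finset.sum_comm]
  have h3 : ∑ i : ι, ∑ _j : ι, ∑ k : ι, Γ (k, i) (k, i) = (Fintype.card ι : ℂ) * ∑ p : ι × ι, Γ p p := by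
    rw [hΓ, Finset.sum_comm (f := fun k i => Γ (k, i) (k, i)), Finset.mul_sum]
    refine Finset.sum_congr rfl fun i _ => ?_
    rw [Finset.sum_const, Finset.card_univ, nsmul_eq_mul]
  have h4 : ∑ _i : ι, ∑ _j : ι, ∑ k : ι, γ k k =
      (Fintype.card ι : ℂ) * ((Fintype.card ι : ℂ) * ∑ k, γ k k) := by
    rw [Finset.sum_const, Finset.card_univ, nsmul_eq_mul, Finset.sum_const, Finset.card_univ,
      nsmul_eq_mul]
  have h5 : ∑ i : ι, ∑ j : ι, ∑ k : ι, (if i = j then Γ (k, i) (k, j) + Γ (k, j) (k, i) - γ k k else 0) =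
      2 * ∑ p : ι × ι, Γ p p - (Fintype.card ι : ℂ) * ∑ k, γ k k := by
    have hswap : ∀ i : ι, ∑ j : ι, ∑ k : ι,
        (if i = j then Γ (k, i) (k, j) + Γ (k, j) (k, i) - γ k k else 0) =
        ∑ k : ι, (Γ (k, i) (k, i) + Γ (k, i) (k, i) - γ k k) := by
      intro i
      rw [Finset.sum_comm]
      refine Finset.sum_congr rfl fun k _ => ?_
      rw [Finset.sum_ite_eq]
      simp only [Finset.mem_univ, if_true]
    simp_rw [hswap]
    simp only [Finset.sum_sub_distrib, Finset.sum_add_distrib]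
    rw [hΓ, Finset.sum_comm (f := fun i k => Γ (k, i) (k, i)), Finset.sum_const, Finset.card_univ,
      nsmul_eq_mul]
    ring
  rw [h0]
  simp only [Finset.sum_add_distrib, Finset.sum_sub_distrib]
  rw [h1, h2, h3, h4, h5]
  ring

/-- **Trace of the `T2` functional** (`Matrix.trace` form of `sum_diag_t2Map_eq_linear`):
`tr T2(γ, Γ) = (2 − r)·tr Γ + r(r−1)·tr γ`, `r = |ι|`. [cite: ChaykinEtAl2016RigorousESC, §4.1 eq. (4.5)] -/
theorem trace_t2Map (γ : Matrix ι ι ℂ) (Γ : Matrix (ι × ι) (ι × ι) ℂ) :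
    (t2Map γ Γ).trace =
      (2 - (Fintype.card ι : ℂ)) * Γ.trace + (Fintype.card ι : ℂ) * ((Fintype.card ι : ℂ) - 1) * γ.trace := by
  simp only [Matrix.trace, Matrix.diag_apply]
  exact sum_diag_t2Map_eq_linear γ Γ

/-- **`tr(T2′) = tr(T2) + tr(γ)`** — the printed line of Chaykin et al. (2016) eq. (4.5), for the block
matrix `T2′ = ( T2 X ; X† γ )` of Nakata et al. (2008) §II.B on an arbitrary pair.
[cite: ChaykinEtAl2016RigorousESC, §4.1 eq. (4.5)] -/
theorem trace_t2PrimeMap (γ : Matrix ι ι ℂ) (Γ : Matrix (ι × ι) (ι × ι) ℂ) :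
    (t2PrimeMap γ Γ).trace = (t2Map γ Γ).trace + γ.trace := by
  rw [t2PrimeMap]
  simp [Matrix.trace, Fintype.sum_sum_type]

/-! ### §2 Compressed-block bookkeeping on the DQG-feasible set

The trace CONSTANTS `IsDQGFeasible.trace_t2Map` (`tr T2 = N(r(r−1) − (r−2)(N−1))`) and
`IsDQGFeasible.trace_t2PrimeMap` (`+ N`) are the sibling's (`PositivityBlockTraces.lean`, imported); the two
lemmas below turn its remark "an ordered-pair family `i<j` carries `1/2` of the corresponding full-index
constant, by the symmetry of the diagonal" into kernel facts. -/

variable {N : ℕ} {γ : Matrix ι ι ℂ} {Γ : Matrix (ι × ι) (ι × ι) ℂ}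

/-- **The diagonal entry of `T2` is symmetric under `(i, j) ↦ (j, i)`** on the DQG-feasible set (both
index pairs of `Γ` antisymmetric): `T2^{jik}_{jik} = T2^{ijk}_{ijk}` — so a programme that keeps ONE member
of each antisymmetric pair of rows `{a†_i a†_j a_k, a†_j a†_i a_k}` (the compressed three-index blocks of
the SDP codes, Chaykin et al. §3.3 `svec`) carries exactly half of the corresponding partial trace.
[cite: ChaykinEtAl2016RigorousESC, §3.3 and §4.1] -/
theorem IsDQGFeasible.t2Map_diag_swap (h : IsDQGFeasible N γ Γ) (i j k : ι) :
    t2Map γ Γ (j, i, k) (j, i, k) = t2Map γ Γ (i, j, k) (i, j, k) := by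
  rw [t2Map_apply_diag', t2Map_apply_diag']
  have e1 : Γ (j, i) (j, i) = Γ (i, j) (i, j) := by
    rw [h.swap_fst i j, h.swap_snd (i, j) i j, neg_neg]
  by_cases hij : i = j
  · subst hij; rfl
  · rw [if_neg hij, if_neg (Ne.symm hij), e1]
    ring

/-- **The rows `a†_i a†_i a_k` carry no trace**: on the DQG-feasible set `T2^{iik}_{iik} = 0`
(`Γ^{ii}_{ii} = 0` by antisymmetry). [cite: NakataEtAl2008, §II.A] -/
theorem IsDQGFeasible.t2Map_diag_eq_zero (h : IsDQGFeasible N γ Γ) (i k : ι) :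
    t2Map γ Γ (i, i, k) (i, i, k) = 0 := by
  rw [t2Map_apply_diag', if_pos rfl]
  have e0 : Γ (i, i) (i, i) = 0 := by
    have := h.swap_fst i i (i, i)
    exact CharZero.eq_neg_self_iff.mp this
  rw [e0]
  ring

/-! ### §3 The eigenvalue form `λ_max ≤ τ` wherever `T2 ⪰ 0` / `T2′ ⪰ 0` is imposed -/

/-- **`λmax(T2) ≤ τ_T2 := N(r(r−1) − (r−2)(N−1))` on the `PQGT1T2`-feasible set**, in Loewner form
`τ_T2·1 − T2(γ, Γ) ⪰ 0` (the a-priori primal bound `x̄·1 − X ⪰ 0` consumed by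
`JanssonChaykinKeil.theorem_3_2`; `τ_T2` is the sibling's `IsDQGFeasible.trace_t2Map`). Chaykin et al.
(2016) eq. (4.6) print `λmax(T2) ≤ Nr(r−N)`; see the module docstring.
[cite: ChaykinEtAl2016RigorousESC, §4.1 eq. (4.6)] -/
theorem IsDQGT1T2Feasible.trace_smul_one_sub_t2Map_posSemidef (h : IsDQGT1T2Feasible N γ Γ) :
    ((((N : ℂ) * ((Fintype.card ι : ℂ) * ((Fintype.card ι : ℂ) - 1) -
        ((Fintype.card ι : ℂ) - 2) * ((N : ℂ) - 1))) •
        (1 : Matrix (ι × ι × ι) (ι × ι × ι) ℂ) - t2Map γ Γ)).PosSemidef := by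
  have ht : (t2Map γ Γ).trace = (N : ℂ) * ((Fintype.card ι : ℂ) * ((Fintype.card ι : ℂ) - 1) -
      ((Fintype.card ι : ℂ) - 2) * ((N : ℂ) - 1)) := by
    simp only [Matrix.trace, Matrix.diag_apply]
    exact h.toIsDQGFeasible.trace_t2Map
  rw [← ht]
  exact posSemidef_trace_smul_one_sub_of_posSemidef h.t2_psd

/-- **`λmax(T2′) ≤ τ_T2′ := N(r(r−1) − (r−2)(N−1)) + N` on the `PQGT1T2′`-feasible set**, in Loewner form
`τ_T2′·1 − T2′(γ, Γ) ⪰ 0` (`τ_T2′` is the sibling's `IsDQGFeasible.trace_t2PrimeMap`). Chaykin et al.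
(2016) eq. (4.6) print `λmax(T2′) ≤ N(r(r−N)+1)`; see the module docstring.
[cite: ChaykinEtAl2016RigorousESC, §4.1 eq. (4.6)] -/
theorem IsDQGT1T2PrimeFeasible.trace_smul_one_sub_t2PrimeMap_posSemidef (h : IsDQGT1T2PrimeFeasible N γ Γ) :
    ((((N : ℂ) * ((Fintype.card ι : ℂ) * ((Fintype.card ι : ℂ) - 1) -
        ((Fintype.card ι : ℂ) - 2) * ((N : ℂ) - 1)) + N) •
        (1 : Matrix ((ι × ι × ι) ⊕ ι) ((ι × ι × ι) ⊕ ι) ℂ) - t2PrimeMap γ Γ)).PosSemidef := by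
  have ht : (t2PrimeMap γ Γ).trace = (N : ℂ) * ((Fintype.card ι : ℂ) * ((Fintype.card ι : ℂ) - 1) -
      ((Fintype.card ι : ℂ) - 2) * ((N : ℂ) - 1)) + N := by
    simp only [Matrix.trace, Matrix.diag_apply]
    exact h.toIsDQGFeasible.trace_t2PrimeMap
  rw [← ht]
  exact posSemidef_trace_smul_one_sub_of_posSemidef h.t2Prime_psd

/-! ### §4 State forms: the `T2` / `T2′` matrices of a unit `N`-particle vector -/

/-- **`tr T2(ψ) = N(r(r−1) − (r−2)(N−1))`** for the anticommutator-form `T2` matrix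
`(⟨ψ| C_I C_J† + C_J† C_I |ψ⟩)`, `C_I = a†_i a†_j a_k`, of a unit `N`-particle vector
(`ThreeIndexConditionsTwoRDM.lean`; `= Σ_I ‖C_I† ψ‖² + ‖C_I ψ‖²`) — the sibling's constant at the state
level (`t2Map_rdm`, `IsDQGFeasible.of_state`). [cite: ChaykinEtAl2016RigorousESC, §4.1 eq. (4.5)] -/
theorem trace_t2Anticomm_of_isNParticle {ψ : Fock ι} (hψN : IsNParticle N ψ) (hψ1 : star ψ ⬝ᵥ ψ = 1) :
    (metricMatrix twoCreateAnnihilate ψ +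
        (metricMatrix (fun t : ι × ι × ι => (twoCreateAnnihilate t)ᴴ) ψ)ᵀ).trace =
      (N : ℂ) * ((Fintype.card ι : ℂ) * ((Fintype.card ι : ℂ) - 1) -
        ((Fintype.card ι : ℂ) - 2) * ((N : ℂ) - 1)) := by
  rw [← t2Map_rdm]
  simp only [Matrix.trace, Matrix.diag_apply]
  exact (IsDQGFeasible.of_state hψN hψ1).trace_t2Map

/-- **`tr T2′(ψ) = N(r(r−1) − (r−2)(N−1)) + N`** for the Braams–Percus–Zhao `T2′` matrix `M(C′) + M(C″)ᵀ`
of a unit `N`-particle vector (`ThreeIndexConditionsT2Prime.lean`, `t2Prime_posSemidef`) — the sibling's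
constant at the state level (`t2PrimeMap_rdm`). [cite: ChaykinEtAl2016RigorousESC, §4.1 eq. (4.5)] -/
theorem trace_t2Prime_of_isNParticle {ψ : Fock ι} (hψN : IsNParticle N ψ) (hψ1 : star ψ ⬝ᵥ ψ = 1) :
    (metricMatrix (Sum.elim twoCreateAnnihilate creation) ψ +
        (metricMatrix (Sum.elim (fun t : ι × ι × ι => (twoCreateAnnihilate t)ᴴ)
          (0 : ι → Matrix (Finset ι) (Finset ι) ℂ)) ψ)ᵀ).trace =
      (N : ℂ) * ((Fintype.card ι : ℂ) * ((Fintype.card ι : ℂ) - 1) -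
        ((Fintype.card ι : ℂ) - 2) * ((N : ℂ) - 1)) + N := by
  rw [← t2PrimeMap_rdm]
  simp only [Matrix.trace, Matrix.diag_apply]
  exact (IsDQGFeasible.of_state hψN hψ1).trace_t2PrimeMap

end Abstract

end Literature.MathematicalPhysics.QuantumChemistry

end
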